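import Literature.Geometry.DiscreteGeometry.KissingPatterns
import HarnessLib

/-!
# `η`-matching under separation: pointwise nearness ⇔ a matching, and the «far point» alternative

Topic `Literature/Geometry/DiscreteGeometry`; companion to `KissingPatterns` (`EtaMatched η T P`: a
bijection `T ≃ P` moving each point by `≤ η`).  Used by the cell `crystal3d-full` (venture
`Summits/Ventures/Crystal3D`, crux `GenericWallFloor`): the E1 ↔ E2 glue and the two-centre exclusion format
state «the free neighbours are `η`-matched to the slots», while the certified computations (branch and
bound, cf-p1 SLOTEX-J2 problem `ONE(η)`) test «some DESIGNATED free ball is farther than `η` from every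
slot».  Under separation the two are complementary:

* `EtaMatched.of_forall_exists_dist_le` — if `|T| = |P|`, the points of `T` are pairwise more than
  `2η` apart, and every `t ∈ T` has SOME `p ∈ P` within `η`, then `T` is `η`-matched to `P`.  (The
  `η`-neighbourhoods in `P` of distinct points of `T` are disjoint and nonempty, so Hall's condition holds
  trivially and a system of distinct representatives is a bijection by counting —
  [cite: Hall1935Representatives, Thm 1]; here proved directly from injectivity + equal cardinality.)
* `exists_forall_lt_dist_of_not_etaMatched` — contrapositive: `|T| = |P|`, `T` `2η`-separated, NOT
  `η`-matched ⇒ some `t ∈ T` is at distance `> η` from EVERY point of `P` (the designated far ball).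
* `not_etaMatched_iff_exists_forall_lt_dist` — the equivalence (Hall's criterion for the disjoint
  family of `η`-neighbourhoods).

WHAT THIS IS NOT: nothing about kissing configurations or certificates; pure finite-set geometry in `ℝ³`.
-/

noncomputable section

namespace Literature.Geometry.DiscreteGeometry

open Finset

/-- Under a matching every point of `T` has a partner in `P` within `η` (unfolding). [folklore] -/
private theorem EtaMatched.exists_dist_le {η : ℝ} {T P : Finset (EuclideanSpace ℝ (Fin 3))} (h : EtaMatched η T P) :
    ∀ t ∈ T, ∃ p ∈ P, dist t p ≤ η := by
  obtain ⟨e, he⟩ := h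
  intro t ht
  exact ⟨(e ⟨t, ht⟩ : (EuclideanSpace ℝ (Fin 3))), (e ⟨t, ht⟩).prop, he ⟨t, ht⟩⟩

/-- **Pointwise nearness under separation is a matching.**  If `T` and `P` have the same number of
points, the points of `T` are pairwise at distance `> 2η`, and every `t ∈ T` has some point of `P`
within distance `η`, then `T` is `η`-matched to `P`.  (Two distinct points of `T` cannot be near the
same point of `P`, so any choice of near partners is injective, hence bijective by counting — the
trivial case of Hall's theorem on distinct representatives.) [cite: Hall1935Representatives, Thm 1] -/
theorem EtaMatched.of_forall_exists_dist_le {η : ℝ} {T P : Finset (EuclideanSpace ℝ (Fin 3))} (hcard : T.card = P.card)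
    (hsep : ∀ t ∈ T, ∀ t' ∈ T, t ≠ t' → 2 * η < dist t t')
    (hnear : ∀ t ∈ T, ∃ p ∈ P, dist t p ≤ η) : EtaMatched η T P := by
  classical
  choose f hfP hfd using hnear
  -- the partner map on the subtype
  set g : ↥T → ↥P := fun t => ⟨f t.1 t.2, hfP t.1 t.2⟩ with hg
  have hginj : Function.Injective g := by
    rintro ⟨t, ht⟩ ⟨t', ht'⟩ hgt
    have hff : f t ht = f t' ht' := by
      have := congrArg (fun z : ↥P => (z : (EuclideanSpace ℝ (Fin 3)))) hgt
      simpa [hg] using this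
    by_contra hne
    have hne' : t ≠ t' := fun h => hne (Subtype.ext h)
    have h1 : dist t t' ≤ dist t (f t ht) + dist (f t ht) t' := dist_triangle _ _ _
    have h2 : dist (f t ht) t' ≤ η := by rw [hff, dist_comm]; exact hfd t' ht'
    have h3 := hsep t ht t' ht' hne'
    have h4 := hfd t ht
    linarith
  have hcard' : Fintype.card ↥T = Fintype.card ↥P := by simpa using hcard
  have hgbij : Function.Bijective g :=
    (Fintype.bijective_iff_injective_and_card g).2 ⟨hginj, hcard'⟩
  refine ⟨Equiv.ofBijective g hgbij, fun t => ?_⟩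
  show dist (t : (EuclideanSpace ℝ (Fin 3))) (f t.1 t.2) ≤ η
  exact hfd t.1 t.2

/-- **The far-point alternative.**  If `|T| = |P|`, the points of `T` are pairwise at distance
`> 2η`, and `T` is NOT `η`-matched to `P`, then some `t ∈ T` is at distance `> η` from every point
of `P`.  (Contrapositive of `EtaMatched.of_forall_exists_dist_le`; in the cell's use `T` = the free
neighbours of a saturated ball, `P` = its vacant slots, `2η < 1`.) [cite: Hall1935Representatives, Thm 1] -/
theorem exists_forall_lt_dist_of_not_etaMatched {η : ℝ} {T P : Finset (EuclideanSpace ℝ (Fin 3))} (hcard : T.card = P.card)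
    (hsep : ∀ t ∈ T, ∀ t' ∈ T, t ≠ t' → 2 * η < dist t t') (hnot : ¬ EtaMatched η T P) :
    ∃ t ∈ T, ∀ p ∈ P, η < dist t p := by
  by_contra h
  push Not at h
  exact hnot (EtaMatched.of_forall_exists_dist_le hcard hsep h)

/-- Conversely, if some `t ∈ T` is at distance `> η` from every point of `P`, then `T` is not
`η`-matched to `P` (no separation needed; the necessity half of Hall's criterion for the family of
`η`-neighbourhoods). [cite: Hall1935Representatives, Thm 1] -/
theorem not_etaMatched_of_exists_forall_lt_dist {η : ℝ} {T P : Finset (EuclideanSpace ℝ (Fin 3))}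
    (h : ∃ t ∈ T, ∀ p ∈ P, η < dist t p) : ¬ EtaMatched η T P := by
  rintro hm
  obtain ⟨t, ht, hfar⟩ := h
  obtain ⟨p, hp, hd⟩ := hm.exists_dist_le t ht
  exact absurd hd (not_le.2 (hfar p hp))

/-- The two formulations are equivalent under separation and equal cardinality (Hall's criterion
for the family of `η`-neighbourhoods, which are pairwise disjoint here). [cite: Hall1935Representatives, Thm 1] -/
theorem not_etaMatched_iff_exists_forall_lt_dist {η : ℝ} {T P : Finset (EuclideanSpace ℝ (Fin 3))} (hcard : T.card = P.card)
    (hsep : ∀ t ∈ T, ∀ t' ∈ T, t ≠ t' → 2 * η < dist t t') :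
    ¬ EtaMatched η T P ↔ ∃ t ∈ T, ∀ p ∈ P, η < dist t p :=
  ⟨exists_forall_lt_dist_of_not_etaMatched hcard hsep, not_etaMatched_of_exists_forall_lt_dist⟩

end Literature.Geometry.DiscreteGeometry

end
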